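import Summits.Ventures.LatticeQCDFlow.Exactness.IMHAnyStartSplit
import HarnessLib

/-!
# Common random numbers: the grand coupling of flow-MCMC — two runs driven by the SAME proposals and the SAME
# uniforms merge onto one `π`-distributed configuration with probability at least `A` per update

HONEST FRAMING: exact (Metropolis-corrected) sampling algorithms for lattice gauge theory;
figures of merit are autocorrelation/cost numbers at stated couplings and volumes; no
continuum-physics claim.

Venture `LatticeQCDFlow` (cell pub-lqcd), topic `Exactness`; FANOUT row 30 (lean-1, GEN-36).  NEW WORK of the
cell, general state space.  GEN-31–35 computed the flow-MCMC chain `K = indepMH q w` (proposal `q`, normalised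
weight `w = dπ/dq`, `π = w·q`, maximal at `x₀`, `A = 1/w(x₀)`, `r = 1 − A`) from one start, from every start, and
for independent replicas; every file recorded «NOT CLAIMED: the joint law of runs sharing proposals or random
numbers».  This file opens that chapter.  A practitioner simulates `K` by a RANDOM MAP: draw the proposal `y ∼ q`
and a uniform `u ∈ [0, 1]`, move `x ↦ y` iff `u·w(x) ≤ w(y)` (i.e. `u ≤ min(1, w(y)/w(x))`), else stay.  Feeding the
SAME `(y, u)` to two runs is the common-random-numbers (CRN) coupling; it induces a Markov kernel `K̂` on `Ω × Ω`.
Def-free (pattern of `Scoring/SplitChain`): a CRN PAIR KERNEL is any Markov kernel `K̂` on `Ω × Ω` with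
`K̂ (x, x′) = (q ⊗ U[0,1]) ∘ (y, u) ↦ (φ_x(y, u), φ_{x′}(y, u))⁻¹`, `φ_x(y, u) = y` if `u·w(x) ≤ w(y)` else `x`
(uniform law = Mathlib's `volume` on `unitInterval`); **`exists_crnPairKernel`** — one exists.

* §1 **`volume_unitInterval_mul_le`** — `U{u : u·a ≤ b} = min(1, b/a)` (`a > 0`, `b ≥ 0`).
* §2 **`map_crnUpdate_eq_indepMH`** — THE RANDOM-MAP REPRESENTATION IS FAITHFUL: the law of `φ_x(y, u)` under
  `q ⊗ U[0,1]` IS `K(x, ·) = indepMH q w x`, for every `x` — what the code does is the kernel the tree reasons about.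
* §3 the pair kernel: **`crnPair_map_fst`**, **`crnPair_map_snd`** — both coordinates of `K̂` move by `K` (a Markov
  coupling of `K` with itself); **`crnPair_weightOrder`** — THE COUPLING IS MONOTONE IN THE WEIGHT ORDER: if
  `w(x′) ≤ w(x)` then `K̂((x, x′), {w(p₂) ≤ w(p₁)}) = 1` (the lighter configuration accepts whenever the heavier one
  does); **`crnPair_ge_diagonal`** — MERGING: `K̂((x, x′), C) ≥ A·π{y : (y, y) ∈ C}` for every measurable
  `C ⊆ Ω × Ω` and every pair — whenever `u ≤ w(y)/w(x₀)` BOTH runs accept the same `y`, so from any two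
  configurations the two runs sit on ONE common `π`-distributed configuration after one update with probability at
  least `A`; the minorising measure is the diagonal lift `π∘(y ↦ (y, y))⁻¹` (no measurability of the diagonal is
  needed); **`crnPair_top_apply`** — EXACT TOP ROW: from a pair containing the mode,
  `K̂((x₀, x′), ·) = A·π∘(y ↦ (y,y))⁻¹ + (1 − A)·(δ_{x₀} ⊗ R(x′, ·))` with `R` the residual kernel of the exact
  minorisation (`Exactness/IMHAnyStartSplit`): either both runs merge onto a fresh target draw (probability EXACTLY
  `A`) or the modal run stays frozen while the other moves by `R`.
Reading (gauge files `Scaling/AutoregressiveGauge…CommonRandomNumbers`): two exact gauge samplers fed the same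
autoregressive proposals and the same uniforms coincide after one update with probability ≥ `A` whatever their
current configurations; the cold run accepts only when every run accepts.
NOT CLAIMED: the merging probability of a specific non-modal pair beyond the bound `A`; anything about runs with
DIFFERENT targets sharing random numbers; the many-step and path laws (next files `…CommonRandomNumbersSplit`,
`…CommonRandomNumbersPath`).  No `sorry`, no new definitions, nothing cited as a fact.
-/

noncomputable section

namespace Summit.Ventures.LatticeQCDFlow.Exactness

open MeasureTheory ProbabilityTheory Function Set
open scoped ENNReal unitInterval
open Literature.Probability.MarkovChains

variable {Ω : Type*} [MeasurableSpace Ω] {q : Measure Ω} [IsProbabilityMeasure q] {w : Ω → ℝ}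

/-! ## §1 The uniform threshold -/

omit [MeasurableSpace Ω] in
/-- **`U{u ∈ [0,1] : u·a ≤ b} = min(1, b/a)`** for `a > 0`, `b ≥ 0` (uniform law = `volume` on `unitInterval`).
[ours, bookkeeping] -/
theorem volume_unitInterval_mul_le {a b : ℝ} (ha : 0 < a) (hb : 0 ≤ b) :
    (volume : Measure unitInterval) {u : unitInterval | (u : ℝ) * a ≤ b} = ENNReal.ofReal (min 1 (b / a)) := by
  by_cases h : b / a < 1
  · have hmem : b / a ∈ unitInterval := ⟨div_nonneg hb ha.le, h.le⟩
    have hset : {u : unitInterval | (u : ℝ) * a ≤ b} = Set.Iic ⟨b / a, hmem⟩ := by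
      ext u
      simp only [mem_setOf_eq, mem_Iic, ← Subtype.coe_le_coe]
      exact (le_div_iff₀ ha).symm
    rw [hset, unitInterval.volume_Iic, min_eq_right h.le]
  · have h : 1 ≤ b / a := not_lt.mp h
    have hset : {u : unitInterval | (u : ℝ) * a ≤ b} = univ := by
      ext u
      simp only [mem_setOf_eq, mem_univ, iff_true]
      have hab : a ≤ b := by rwa [one_le_div ha] at h
      calc (u : ℝ) * a ≤ 1 * a := by gcongr; exact u.2.2
        _ = a := one_mul a
        _ ≤ b := hab
    rw [hset, measure_univ, min_eq_left h, ENNReal.ofReal_one]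

omit [MeasurableSpace Ω] in
/-- `U{u : u·w(x) ≤ w(y)} = a(x, y)` — the CRN rule accepts exactly with the Metropolis probability. [ours] -/
theorem volume_unitInterval_accept (hw0 : ∀ y, 0 < w y) (x y : Ω) :
    (volume : Measure unitInterval) {u : unitInterval | (u : ℝ) * w x ≤ w y} = imhAcceptE w x y := by
  rw [volume_unitInterval_mul_le (hw0 x) (hw0 y).le]; rfl

omit [MeasurableSpace Ω] in
/-- The complementary event: `U{u : ¬ u·w(x) ≤ w(y)} = 1 − a(x, y)`. [ours] -/
theorem volume_unitInterval_reject (hw0 : ∀ y, 0 < w y) (x y : Ω) :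
    (volume : Measure unitInterval) {u : unitInterval | ¬ ((u : ℝ) * w x ≤ w y)} = 1 - imhAcceptE w x y := by
  have hms : MeasurableSet {u : unitInterval | (u : ℝ) * w x ≤ w y} :=
    measurableSet_le ((measurable_subtype_coe).mul_const _) measurable_const
  rw [show {u : unitInterval | ¬ ((u : ℝ) * w x ≤ w y)} = {u : unitInterval | (u : ℝ) * w x ≤ w y}ᶜ from rfl,
    prob_compl_eq_one_sub hms, volume_unitInterval_accept hw0]

/-! ## §2 The random-map representation is faithful -/

/-- Measurability of the CRN update `(y, u) ↦ φ_x(y, u)` for a fixed current configuration `x`. [ours] -/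
theorem measurable_crnUpdate (hw : Measurable w) (x : Ω) :
    Measurable (fun p : Ω × unitInterval => if (p.2 : ℝ) * w x ≤ w p.1 then p.1 else x) :=
  Measurable.ite (measurableSet_le ((measurable_subtype_coe.comp measurable_snd).mul_const _)
    (hw.comp measurable_fst)) measurable_fst measurable_const

/-- Joint measurability of the CRN pair update `((x, x′), (y, u)) ↦ (φ_x(y, u), φ_{x′}(y, u))`. [ours] -/
theorem measurable_crnPairUpdate (hw : Measurable w) :
    Measurable (fun zp : (Ω × Ω) × (Ω × unitInterval) =>
      ((if (zp.2.2 : ℝ) * w zp.1.1 ≤ w zp.2.1 then zp.2.1 else zp.1.1),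
        (if (zp.2.2 : ℝ) * w zp.1.2 ≤ w zp.2.1 then zp.2.1 else zp.1.2))) := by
  have hu : Measurable (fun zp : (Ω × Ω) × (Ω × unitInterval) => (zp.2.2 : ℝ)) :=
    measurable_subtype_coe.comp (measurable_snd.comp measurable_snd)
  have hy : Measurable (fun zp : (Ω × Ω) × (Ω × unitInterval) => w zp.2.1) :=
    hw.comp (measurable_fst.comp measurable_snd)
  refine Measurable.prodMk ?_ ?_
  · exact Measurable.ite (measurableSet_le (hu.mul (hw.comp (measurable_fst.comp measurable_fst))) hy)
      (measurable_fst.comp measurable_snd) (measurable_fst.comp measurable_fst)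
  · exact Measurable.ite (measurableSet_le (hu.mul (hw.comp (measurable_snd.comp measurable_fst))) hy)
      (measurable_fst.comp measurable_snd) (measurable_snd.comp measurable_fst)

/-- For a fixed pair `z = (x, x′)`, measurability of `(y, u) ↦ (φ_x(y, u), φ_{x′}(y, u))`. [ours] -/
theorem measurable_crnPairUpdate_apply (hw : Measurable w) (z : Ω × Ω) :
    Measurable (fun p : Ω × unitInterval =>
      ((if (p.2 : ℝ) * w z.1 ≤ w p.1 then p.1 else z.1), (if (p.2 : ℝ) * w z.2 ≤ w p.1 then p.1 else z.2))) :=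
  (measurable_crnUpdate hw z.1).prodMk (measurable_crnUpdate hw z.2)

omit [MeasurableSpace Ω] in
/-- The `u`-section of the event `{φ_x(y, u) ∈ B}` at a fixed proposal `y` has uniform measure
`1_B(y)·a(x, y) + 1_B(x)·(1 − a(x, y))`. [ours] -/
theorem volume_section_crnUpdate (hw0 : ∀ y, 0 < w y) (x y : Ω) (B : Set Ω) :
    (volume : Measure unitInterval)
        {u : unitInterval | (if (u : ℝ) * w x ≤ w y then y else x) ∈ B} =
      B.indicator (imhAcceptE w x) y + B.indicator 1 x * (1 - imhAcceptE w x y) := by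
  by_cases hy : y ∈ B <;> by_cases hx : x ∈ B
  · have hset : {u : unitInterval | (if (u : ℝ) * w x ≤ w y then y else x) ∈ B} = univ := by
      ext u; simp only [mem_setOf_eq, mem_univ, iff_true]; split_ifs <;> assumption
    rw [hset, measure_univ, indicator_of_mem hy, indicator_of_mem hx, Pi.one_apply, one_mul,
      add_tsub_cancel_of_le (imhAcceptE_le_one w x y)]
  · have hset : {u : unitInterval | (if (u : ℝ) * w x ≤ w y then y else x) ∈ B} =
        {u : unitInterval | (u : ℝ) * w x ≤ w y} := by
      ext u; simp only [mem_setOf_eq]; split_ifs with h <;> simp [h, hy, hx]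
    rw [hset, volume_unitInterval_accept hw0, indicator_of_mem hy, indicator_of_notMem hx, zero_mul, add_zero]
  · have hset : {u : unitInterval | (if (u : ℝ) * w x ≤ w y then y else x) ∈ B} =
        {u : unitInterval | ¬ ((u : ℝ) * w x ≤ w y)} := by
      ext u; simp only [mem_setOf_eq]; split_ifs with h <;> simp [h, hy, hx]
    rw [hset, volume_unitInterval_reject hw0, indicator_of_notMem hy, indicator_of_mem hx, Pi.one_apply,
      one_mul, zero_add]
  · have hset : {u : unitInterval | (if (u : ℝ) * w x ≤ w y then y else x) ∈ B} = ∅ := by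
      ext u; simp only [mem_setOf_eq, mem_empty_iff_false, iff_false]; split_ifs <;> assumption
    rw [hset, measure_empty, indicator_of_notMem hy, indicator_of_notMem hx, zero_mul, add_zero]

/-- **THE RANDOM-MAP REPRESENTATION IS FAITHFUL.**  `w` measurable and positive.  For every current configuration
`x`, the law of the CRN update `φ_x(y, u)` (`y ∼ q`, `u ∼ U[0,1]` independent; move to `y` iff `u·w(x) ≤ w(y)`) IS
the flow-MCMC kernel: `(q ⊗ U) ∘ φ_x⁻¹ = indepMH q w x`. [ours] -/
theorem map_crnUpdate_eq_indepMH (hw : Measurable w) (hw0 : ∀ y, 0 < w y) (x : Ω) :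
    (q.prod (volume : Measure unitInterval)).map
        (fun p : Ω × unitInterval => if (p.2 : ℝ) * w x ≤ w p.1 then p.1 else x) = indepMH q w x := by
  haveI : Fact (Measurable w) := ⟨hw⟩
  ext B hB
  have hax : Measurable (imhAcceptE w x) := (measurable_imhAcceptE hw).comp measurable_prodMk_left
  rw [Measure.map_apply (measurable_crnUpdate hw x) hB, Measure.prod_apply ((measurable_crnUpdate hw x) hB),
    indepMH_apply hw x hB]
  have hsec : ∀ y, (volume : Measure unitInterval)
      (Prod.mk y ⁻¹' ((fun p : Ω × unitInterval => if (p.2 : ℝ) * w x ≤ w p.1 then p.1 else x) ⁻¹' B)) =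
      B.indicator (imhAcceptE w x) y + B.indicator 1 x * (1 - imhAcceptE w x y) := fun y =>
    volume_section_crnUpdate hw0 x y B
  simp_rw [hsec]
  have hfin : ∫⁻ a, imhAcceptE w x a ∂q ≠ ⊤ := by
    refine ne_top_of_le_ne_top ENNReal.one_ne_top ?_
    calc ∫⁻ a, imhAcceptE w x a ∂q ≤ ∫⁻ _, 1 ∂q := lintegral_mono fun y => imhAcceptE_le_one w x y
      _ = 1 := by rw [lintegral_const, measure_univ, mul_one]
  rw [lintegral_add_left (hax.indicator hB), lintegral_indicator hB, lintegral_const_mul _ (hax.const_sub 1),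
    lintegral_sub hax hfin (ae_of_all _ fun y => imhAcceptE_le_one w x y), lintegral_const, measure_univ,
    mul_one, mul_comm]
  rfl

/-! ## §3 The CRN pair kernel -/

/-- **A CRN pair kernel exists** (and is Markov): `z = (x, x′) ↦ (q ⊗ U) ∘ (φ_x, φ_{x′})⁻¹` is a measurable family
of probability laws on `Ω × Ω`. [ours] -/
theorem exists_crnPairKernel (hw : Measurable w) :
    ∃ Khat : Kernel (Ω × Ω) (Ω × Ω), IsMarkovKernel Khat ∧ ∀ z : Ω × Ω,
      Khat z = (q.prod (volume : Measure unitInterval)).map (fun p : Ω × unitInterval =>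
        ((if (p.2 : ℝ) * w z.1 ≤ w p.1 then p.1 else z.1), (if (p.2 : ℝ) * w z.2 ≤ w p.1 then p.1 else z.2))) := by
  refine ⟨Kernel.map ((Kernel.deterministic id measurable_id) ×ₖ
      (Kernel.const (Ω × Ω) (q.prod (volume : Measure unitInterval))))
      (fun zp : (Ω × Ω) × (Ω × unitInterval) =>
        ((if (zp.2.2 : ℝ) * w zp.1.1 ≤ w zp.2.1 then zp.2.1 else zp.1.1),
          (if (zp.2.2 : ℝ) * w zp.1.2 ≤ w zp.2.1 then zp.2.1 else zp.1.2))), ?_, fun z => ?_⟩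
  · exact Kernel.IsMarkovKernel.map _ (measurable_crnPairUpdate hw)
  · rw [Kernel.map_apply _ (measurable_crnPairUpdate hw), Kernel.prod_apply, Kernel.deterministic_apply,
      Kernel.const_apply, Measure.dirac_prod, Measure.map_map (measurable_crnPairUpdate hw) measurable_prodMk_left]
    rfl

/-- **FIRST MARGINAL**: the first coordinate of a CRN pair kernel moves by `K`:
`K̂(x, x′) ∘ fst⁻¹ = indepMH q w x`. [ours] -/
theorem crnPair_map_fst (hw : Measurable w) (hw0 : ∀ y, 0 < w y) (Khat : Kernel (Ω × Ω) (Ω × Ω))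
    (hK : ∀ z : Ω × Ω, Khat z = (q.prod (volume : Measure unitInterval)).map (fun p : Ω × unitInterval =>
      ((if (p.2 : ℝ) * w z.1 ≤ w p.1 then p.1 else z.1), (if (p.2 : ℝ) * w z.2 ≤ w p.1 then p.1 else z.2))))
    (z : Ω × Ω) : (Khat z).map Prod.fst = indepMH q w z.1 := by
  rw [hK z, Measure.map_map measurable_fst (measurable_crnPairUpdate_apply hw z)]
  exact map_crnUpdate_eq_indepMH hw hw0 z.1

/-- **SECOND MARGINAL**: `K̂(x, x′) ∘ snd⁻¹ = indepMH q w x′`. [ours] -/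
theorem crnPair_map_snd (hw : Measurable w) (hw0 : ∀ y, 0 < w y) (Khat : Kernel (Ω × Ω) (Ω × Ω))
    (hK : ∀ z : Ω × Ω, Khat z = (q.prod (volume : Measure unitInterval)).map (fun p : Ω × unitInterval =>
      ((if (p.2 : ℝ) * w z.1 ≤ w p.1 then p.1 else z.1), (if (p.2 : ℝ) * w z.2 ≤ w p.1 then p.1 else z.2))))
    (z : Ω × Ω) : (Khat z).map Prod.snd = indepMH q w z.2 := by
  rw [hK z, Measure.map_map measurable_snd (measurable_crnPairUpdate_apply hw z)]
  exact map_crnUpdate_eq_indepMH hw hw0 z.2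

omit [MeasurableSpace Ω] in
/-- **The CRN update is monotone in the weight order** (sure property of the random map): for a positive weight,
if `w(x′) ≤ w(x)` then `w(φ_{x′}(y, u)) ≤ w(φ_x(y, u))` for every proposal `y` and every `u ∈ [0, 1]`. [ours] -/
theorem crnUpdate_weight_mono (hw0 : ∀ y, 0 < w y) {x x' : Ω} (hle : w x' ≤ w x) (y : Ω) (u : unitInterval) :
    w (if (u : ℝ) * w x' ≤ w y then y else x') ≤ w (if (u : ℝ) * w x ≤ w y then y else x) := by
  have hu0 : 0 ≤ (u : ℝ) := u.2.1
  have hu1 : (u : ℝ) ≤ 1 := u.2.2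
  by_cases h : (u : ℝ) * w x ≤ w y
  · have h' : (u : ℝ) * w x' ≤ w y := (mul_le_mul_of_nonneg_left hle hu0).trans h
    rw [if_pos h, if_pos h']
  · rw [if_neg h]
    have hlt : w y < (u : ℝ) * w x := not_le.mp h
    by_cases h' : (u : ℝ) * w x' ≤ w y
    · rw [if_pos h']
      exact (hlt.trans_le (mul_le_of_le_one_left (hw0 x).le hu1)).le
    · rw [if_neg h']; exact hle

/-- **THE COUPLING IS MONOTONE IN THE WEIGHT ORDER**: if `w(x′) ≤ w(x)` then after one CRN update the second
run is still (weakly) lighter: `K̂((x, x′), {p : w(p₂) ≤ w(p₁)}) = 1`.  In particular every run stays lighter than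
the run started at the mode, update by update. [ours] -/
theorem crnPair_weightOrder (hw : Measurable w) (hw0 : ∀ y, 0 < w y) (Khat : Kernel (Ω × Ω) (Ω × Ω))
    (hK : ∀ z : Ω × Ω, Khat z = (q.prod (volume : Measure unitInterval)).map (fun p : Ω × unitInterval =>
      ((if (p.2 : ℝ) * w z.1 ≤ w p.1 then p.1 else z.1), (if (p.2 : ℝ) * w z.2 ≤ w p.1 then p.1 else z.2))))
    {z : Ω × Ω} (hle : w z.2 ≤ w z.1) : Khat z {p : Ω × Ω | w p.2 ≤ w p.1} = 1 := by
  have hC : MeasurableSet {p : Ω × Ω | w p.2 ≤ w p.1} :=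
    measurableSet_le (hw.comp measurable_snd) (hw.comp measurable_fst)
  rw [hK z, Measure.map_apply (measurable_crnPairUpdate_apply hw z) hC]
  have hset : (fun p : Ω × unitInterval =>
      ((if (p.2 : ℝ) * w z.1 ≤ w p.1 then p.1 else z.1), (if (p.2 : ℝ) * w z.2 ≤ w p.1 then p.1 else z.2))) ⁻¹'
        {p : Ω × Ω | w p.2 ≤ w p.1} = univ := by
    ext p
    simp only [mem_preimage, mem_setOf_eq, mem_univ, iff_true]
    exact crnUpdate_weight_mono hw0 hle p.1 p.2
  rw [hset, measure_univ]

omit [IsProbabilityMeasure q] in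
/-- **MERGING — the diagonal minorisation.**  `w` measurable, positive, maximal at `x₀`.  For every pair `z` and every
measurable `C ⊆ Ω × Ω`: `(1/w(x₀))·π{y : (y, y) ∈ C} ≤ K̂(z, C)` — whenever `u·w(x₀) ≤ w(y)` both runs accept the
common proposal `y`, so with probability at least `A` per update the two runs coincide at a fresh `π`-distributed
configuration, whatever their current configurations.  (The minorising measure is the diagonal lift of the
target; no measurability of the diagonal is used.) [ours] -/
theorem crnPair_ge_diagonal (hw : Measurable w) (hw0 : ∀ y, 0 < w y) {x₀ : Ω} (hmax : ∀ y, w y ≤ w x₀)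
    (Khat : Kernel (Ω × Ω) (Ω × Ω))
    (hK : ∀ z : Ω × Ω, Khat z = (q.prod (volume : Measure unitInterval)).map (fun p : Ω × unitInterval =>
      ((if (p.2 : ℝ) * w z.1 ≤ w p.1 then p.1 else z.1), (if (p.2 : ℝ) * w z.2 ≤ w p.1 then p.1 else z.2))))
    (z : Ω × Ω) {C : Set (Ω × Ω)} (hC : MeasurableSet C) :
    ENNReal.ofReal (w x₀)⁻¹ * (q.withDensity fun y => ENNReal.ofReal (w y)) {y | (y, y) ∈ C} ≤ Khat z C := by
  have hdiag : Measurable (fun y : Ω => (y, y)) := measurable_id.prodMk measurable_id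
  have hD : MeasurableSet {y : Ω | (y, y) ∈ C} := hdiag hC
  have hW : 0 < w x₀ := hw0 x₀
  rw [hK z, Measure.map_apply (measurable_crnPairUpdate_apply hw z) hC,
    Measure.prod_apply ((measurable_crnPairUpdate_apply hw z) hC), withDensity_apply _ hD]
  -- the event `{u·w(x₀) ≤ w(y), (y, y) ∈ C}` is contained in the preimage, section by section
  calc ENNReal.ofReal (w x₀)⁻¹ * ∫⁻ y in {y | (y, y) ∈ C}, ENNReal.ofReal (w y) ∂q
      = ∫⁻ y, {y | (y, y) ∈ C}.indicator (fun y => ENNReal.ofReal (w y / w x₀)) y ∂q := by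
        rw [← lintegral_indicator hD, ← lintegral_const_mul _ ((hw.ennreal_ofReal).indicator hD)]
        refine lintegral_congr fun y => ?_
        by_cases hy : y ∈ {y | (y, y) ∈ C}
        · rw [indicator_of_mem hy, indicator_of_mem hy, div_eq_inv_mul,
            ENNReal.ofReal_mul (inv_nonneg.mpr hW.le)]
        · rw [indicator_of_notMem hy, indicator_of_notMem hy, mul_zero]
    _ ≤ ∫⁻ y, (volume : Measure unitInterval) (Prod.mk y ⁻¹' ((fun p : Ω × unitInterval =>
          ((if (p.2 : ℝ) * w z.1 ≤ w p.1 then p.1 else z.1), (if (p.2 : ℝ) * w z.2 ≤ w p.1 then p.1 else z.2)))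
            ⁻¹' C)) ∂q := by
        refine lintegral_mono fun y => ?_
        by_cases hy : y ∈ {y | (y, y) ∈ C}
        · rw [indicator_of_mem hy]
          have hsub : {u : unitInterval | (u : ℝ) * w x₀ ≤ w y} ⊆ Prod.mk y ⁻¹' ((fun p : Ω × unitInterval =>
              ((if (p.2 : ℝ) * w z.1 ≤ w p.1 then p.1 else z.1),
                (if (p.2 : ℝ) * w z.2 ≤ w p.1 then p.1 else z.2))) ⁻¹' C) := by
            intro u hu
            have hu0 : 0 ≤ (u : ℝ) := u.2.1
            have h1 : (u : ℝ) * w z.1 ≤ w y := (mul_le_mul_of_nonneg_left (hmax z.1) hu0).trans hu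
            have h2 : (u : ℝ) * w z.2 ≤ w y := (mul_le_mul_of_nonneg_left (hmax z.2) hu0).trans hu
            simp only [mem_preimage, if_pos h1, if_pos h2]
            exact hy
          calc ENNReal.ofReal (w y / w x₀) = ENNReal.ofReal (min 1 (w y / w x₀)) := by
                rw [min_eq_right ((div_le_one hW).2 (hmax y))]
            _ = (volume : Measure unitInterval) {u : unitInterval | (u : ℝ) * w x₀ ≤ w y} :=
                (volume_unitInterval_mul_le hW (hw0 y).le).symm
            _ ≤ _ := measure_mono hsub
        · rw [indicator_of_notMem hy]; exact bot_le

/-- **RUNS THAT HAVE MET STAY TOGETHER**: from a diagonal pair the CRN pair kernel is the diagonal lift of `K` —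
`K̂((x, x), ·) = K(x, ·)∘(y ↦ (y, y))⁻¹` (both runs receive the same proposal and the same uniform and sit at the
same configuration, so they take the same decision). [ours] -/
theorem crnPair_diag_apply (hw : Measurable w) (hw0 : ∀ y, 0 < w y) (Khat : Kernel (Ω × Ω) (Ω × Ω))
    (hK : ∀ z : Ω × Ω, Khat z = (q.prod (volume : Measure unitInterval)).map (fun p : Ω × unitInterval =>
      ((if (p.2 : ℝ) * w z.1 ≤ w p.1 then p.1 else z.1), (if (p.2 : ℝ) * w z.2 ≤ w p.1 then p.1 else z.2))))
    (x : Ω) : Khat (x, x) = (indepMH q w x).map (fun y : Ω => (y, y)) := by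
  have hdiag : Measurable (fun y : Ω => (y, y)) := measurable_id.prodMk measurable_id
  rw [hK (x, x), ← map_crnUpdate_eq_indepMH hw hw0 x, Measure.map_map hdiag (measurable_crnUpdate hw x)]
  rfl

end Summit.Ventures.LatticeQCDFlow.Exactness

end
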